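import Summits.QuantumAdvantage.AdviceFreeQNC0.BlockRigidity
import Mathlib.Algebra.Polynomial.Roots
import HarnessLib

/-!
# Cell qa-qnc0, `p = 3` — the BLOCK LEMMA `blockOpR_contracts` (planner qa-qnc0-p1 g20, ask P-20e stub 2;
ROUND-19 §3; `exp20/Sketch20x.lean` §7, statement VERBATIM)

**`blockOpR_contracts (r) : ∃ ρ, 0 ≤ ρ ∧ ρ < 1 ∧ ∀ ζ (primitive cube root) ω (cube roots) ε f,
rnsq (blockOpR ζ ω ε f) ≤ ρ² · rnsq f`** — on the bond-twisted register chain of radius `r`, every block of `2r+1`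
consecutive site operators starting at a twisted site is a UNIFORM strict `ℓ²`-contraction, for arbitrary `{±1}` sign
patterns (= arbitrary `r`-local bell rules) and arbitrary cube-root phases at the later sites.

Proof: rigidity (`chain_rigid`, `BlockRigidity.lean`: no nonzero norm-preserved vector) + compactness of the unit sphere
of `ℓ²(RegState r)` (`exists_rho_of_rigid`) + finiteness of the parameter set (`exists_uniform_rho`; cube roots via
`Polynomial.nthRootsFinset`).  This is the analytic input of `TwistBoundX3Local` (Sketch20x §7: remaining stub =
the path-sum bookkeeping `twistBoundX3Local_of`).

WHAT THIS IS NOT: not quantitative (`blockOpR_contracts_quant`, P-20e′, open); no strategy bound by itself; crux 22907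
untouched; separation NOT moved.
-/

namespace Summit.QuantumAdvantage.AdviceFreeQNC0

open Finset Literature.Computability.QuantumComplexity

namespace BondTwist3

variable {r : ℕ}

/-! ## Elementary facts on `rnsq` -/

/-- `rnsq ≥ 0`. -/
theorem rnsq_nonneg (f : RegState r → ℂ) : 0 ≤ rnsq f := by
  unfold rnsq; positivity

/-- `rnsq (a·f) = ‖a‖² rnsq f`. -/
theorem rnsq_smul (a : ℂ) (f : RegState r → ℂ) : rnsq (fun τ => a * f τ) = ‖a‖ ^ 2 * rnsq f := by
  unfold rnsq
  rw [mul_sum]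
  exact sum_congr rfl fun τ _ => by rw [norm_mul, mul_pow]

/-- `rnsq f = 0` only for `f = 0`. -/
theorem rnsq_eq_zero (f : RegState r → ℂ) (h : rnsq f = 0) : f = 0 := by
  unfold rnsq at h
  funext τ
  have := (sum_eq_zero_iff_of_nonneg fun σ _ => by positivity).1 h τ (mem_univ _)
  simpa using this

/-! ## Continuity -/

/-- The site operator is continuous in `f`. -/
theorem continuous_siteOpR (ζ : ℂ) (ε : RegState r → Bool → Bool) :
    Continuous fun f : RegState r → ℂ => siteOpR ζ ε f := by
  refine continuous_pi fun σ => ?_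
  have h0 : Continuous fun f : RegState r → ℂ => f (nextState σ false) := continuous_apply _
  have h1 : Continuous fun f : RegState r → ℂ => f (nextState σ true) := continuous_apply _
  have h := ((continuous_const (y := (if ε σ false then (-1 : ℂ) else 1))).mul h0).add
    ((continuous_const (y := ζ * (if ε σ true then (-1 : ℂ) else 1))).mul h1)
  have h' := h.div_const (2 : ℂ)
  refine h'.congr fun f => ?_
  simp only [siteOpR, Pi.add_apply, Pi.mul_apply]

/-- Chains are continuous in `f`. -/
theorem continuous_chainOp (l : List (ℂ × (RegState r → Bool → Bool))) :
    Continuous fun f : RegState r → ℂ => chainOp l f := by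
  induction l with
  | nil => exact continuous_id
  | cons p l ih => exact (continuous_siteOpR p.1 p.2).comp ih

/-- `rnsq` is continuous. -/
theorem continuous_rnsq : Continuous fun f : RegState r → ℂ => rnsq f := by
  unfold rnsq
  exact continuous_finsetSum _ fun σ _ => ((continuous_apply σ).norm).pow 2

/-! ## Compactness: rigidity gives a strict contraction -/

/-- **From rigidity to a norm bound**: a chain of contractions without nonzero norm-preserved vectors contracts by a
factor `ρ < 1` (maximum of `rnsq ∘ chainOp l` on the compact unit sphere). -/
theorem exists_rho_of_rigid (l : List (ℂ × (RegState r → Bool → Bool))) (hl : ∀ p ∈ l, ‖p.1‖ ≤ 1)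
    (hrig : ∀ f, rnsq f ≤ rnsq (chainOp l f) → f = 0) :
    ∃ ρ : ℝ, 0 ≤ ρ ∧ ρ < 1 ∧ ∀ f, rnsq (chainOp l f) ≤ ρ ^ 2 * rnsq f := by
  set S : Set (RegState r → ℂ) := {f | rnsq f = 1} with hS
  have hSc : IsCompact S := by
    refine Metric.isCompact_of_isClosed_isBounded (isClosed_eq continuous_rnsq continuous_const) ?_
    refine (Metric.isBounded_closedBall (x := (0 : RegState r → ℂ)) (r := 1)).subset fun f hf => ?_
    rw [mem_closedBall_zero_iff, pi_norm_le_iff_of_nonneg zero_le_one]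
    intro σ
    have h1 : ‖f σ‖ ^ 2 ≤ rnsq f := by
      unfold rnsq
      exact Finset.single_le_sum (f := fun τ => ‖f τ‖ ^ 2) (fun τ _ => by positivity) (mem_univ σ)
    have hf1 : rnsq f = 1 := hf
    rw [hf1] at h1
    nlinarith [norm_nonneg (f σ)]
  -- the sphere is nonempty
  let τ₀ : RegState r := (0, false, fun _ => false)
  let f₀ : RegState r → ℂ := fun τ => if τ = τ₀ then 1 else 0
  have hf₀ : f₀ ∈ S := by
    show rnsq f₀ = 1
    unfold rnsq
    have : ∀ τ, ‖f₀ τ‖ ^ 2 = if τ = τ₀ then 1 else 0 := by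
      intro τ; by_cases h : τ = τ₀ <;> simp [f₀, h]
    simp_rw [this]
    rw [Finset.sum_ite_eq']
    simp
  obtain ⟨g, hgS, hmax⟩ := hSc.exists_isMaxOn ⟨f₀, hf₀⟩
    ((continuous_rnsq.comp (continuous_chainOp l)).continuousOn)
  have hg1 : rnsq g = 1 := hgS
  set M := rnsq (chainOp l g) with hM
  have hM0 : 0 ≤ M := rnsq_nonneg _
  have hM1 : M < 1 := by
    rcases (rnsq_chainOp_le l hl g).lt_or_eq with h | h
    · rw [hg1] at h; exact h
    · exfalso
      have hg0 := hrig g h.ge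
      rw [hg0] at hg1
      simp [rnsq] at hg1
  refine ⟨Real.sqrt M, Real.sqrt_nonneg _, (Real.sqrt_lt' one_pos).2 (by simpa using hM1), fun f => ?_⟩
  rw [Real.sq_sqrt hM0]
  by_cases hf0 : rnsq f = 0
  · have hf := rnsq_eq_zero f hf0
    subst hf
    have h := rnsq_chainOp_le l hl (0 : RegState r → ℂ)
    rw [hf0] at h ⊢
    simpa using h
  · have hpos : 0 < rnsq f := lt_of_le_of_ne (rnsq_nonneg f) (Ne.symm hf0)
    set c := Real.sqrt (rnsq f) with hc
    have hcpos : 0 < c := Real.sqrt_pos.2 hpos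
    have hc2 : c ^ 2 = rnsq f := Real.sq_sqrt hpos.le
    have hnc : ‖((c⁻¹ : ℝ) : ℂ)‖ = c⁻¹ := by
      rw [Complex.norm_real, Real.norm_eq_abs, abs_of_pos (inv_pos.2 hcpos)]
    have hu : (fun τ => ((c⁻¹ : ℝ) : ℂ) * f τ) ∈ S := by
      show rnsq (fun τ => ((c⁻¹ : ℝ) : ℂ) * f τ) = 1
      rw [rnsq_smul, hnc, ← hc2, inv_pow]
      exact inv_mul_cancel₀ (pow_ne_zero 2 hcpos.ne')
    have hle : rnsq (chainOp l (fun τ => ((c⁻¹ : ℝ) : ℂ) * f τ)) ≤ M := isMaxOn_iff.1 hmax _ hu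
    rw [chainOp_smul, rnsq_smul, hnc, inv_pow, hc2] at hle
    calc rnsq (chainOp l f) = rnsq f * ((rnsq f)⁻¹ * rnsq (chainOp l f)) := by
          rw [← mul_assoc, mul_inv_cancel₀ hf0, one_mul]
      _ ≤ rnsq f * M := mul_le_mul_of_nonneg_left hle hpos.le
      _ = M * rnsq f := mul_comm _ _

/-! ## Finitely many parameters -/

/-- A finite family of strict contraction factors has a common one. -/
theorem exists_uniform_rho {α : Type*} [DecidableEq α] (P : Finset α) (Q : α → ℝ → Prop)
    (hmono : ∀ a ρ ρ', 0 ≤ ρ → ρ ≤ ρ' → Q a ρ → Q a ρ')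
    (h : ∀ a ∈ P, ∃ ρ : ℝ, 0 ≤ ρ ∧ ρ < 1 ∧ Q a ρ) :
    ∃ ρ : ℝ, 0 ≤ ρ ∧ ρ < 1 ∧ ∀ a ∈ P, Q a ρ := by
  induction P using Finset.induction_on with
  | empty => exact ⟨0, le_rfl, one_pos, by simp⟩
  | @insert a s _ ih =>
    obtain ⟨ρ₁, h1, h1', hQ1⟩ := h a (Finset.mem_insert_self a s)
    obtain ⟨ρ₂, h2, h2', hQ2⟩ := ih fun b hb => h b (Finset.mem_insert_of_mem hb)
    refine ⟨max ρ₁ ρ₂, le_max_of_le_left h1, max_lt h1' h2', fun b hb => ?_⟩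
    rw [Finset.mem_insert] at hb
    rcases hb with rfl | hb
    · exact hmono _ _ _ h1 (le_max_left _ _) hQ1
    · exact hmono _ _ _ h2 (le_max_right _ _) (hQ2 b hb)

/-! ## The block lemma -/

/-- **P-20e stub 2 — THE BLOCK LEMMA (`blockOpR_contracts`) — PROVED.**  For a primitive cube root `ζ` at the first
site, arbitrary cube-root phases later and arbitrary sign patterns, the `(2r+1)`-block strictly contracts, uniformly. -/
theorem blockOpR_contracts (r : ℕ) : ∃ ρ : ℝ, 0 ≤ ρ ∧ ρ < 1 ∧
    ∀ (ζ : ℂ), ζ ^ 3 = 1 → ζ ≠ 1 →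
    ∀ (ω : Fin (2 * r) → ℂ), (∀ j, ω j ^ 3 = 1) →
    ∀ (ε : Fin (2 * r + 1) → RegState r → Bool → Bool) (f : RegState r → ℂ),
      rnsq (blockOpR ζ ω ε f) ≤ ρ ^ 2 * rnsq f := by
  classical
  set R : Finset ℂ := Polynomial.nthRootsFinset 3 (1 : ℂ) with hR
  have hmem : ∀ {z : ℂ}, z ∈ R ↔ z ^ 3 = 1 := fun {z} => by
    rw [hR, Polynomial.mem_nthRootsFinset (by norm_num)]
  set P := ((R.filter fun z => z ≠ 1) ×ˢ Fintype.piFinset fun _ : Fin (2 * r) => R) ×ˢ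
    (Finset.univ : Finset (Fin (2 * r + 1) → RegState r → Bool → Bool)) with hP
  obtain ⟨ρ, h0, h1, hQ⟩ := exists_uniform_rho P
    (fun a ρ => ∀ f : RegState r → ℂ, rnsq (blockOpR a.1.1 a.1.2 a.2 f) ≤ ρ ^ 2 * rnsq f)
    (fun a ρ ρ' hρ hρρ' hq f => (hq f).trans
      (mul_le_mul_of_nonneg_right (pow_le_pow_left₀ hρ hρρ' 2) (rnsq_nonneg f)))
    (by
      rintro ⟨⟨ζ, ω⟩, ε⟩ ha
      simp only [hP, Finset.mem_product, Finset.mem_filter, Fintype.mem_piFinset, Finset.mem_univ,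
        and_true] at ha
      obtain ⟨⟨hζR, hζ1⟩, hω⟩ := ha
      have hζ3 : ζ ^ 3 = 1 := hmem.1 hζR
      have hl1 : ∀ p ∈ (List.ofFn fun j : Fin (2 * r) => (ω j, ε j.succ)), ‖p.1‖ = 1 := by
        intro p hp
        rw [List.mem_ofFn', Set.mem_range] at hp
        obtain ⟨j, rfl⟩ := hp
        exact norm_eq_one_of_cube (hmem.1 (hω j))
      obtain ⟨ρ, h0, h1, h⟩ := exists_rho_of_rigid
        ((ζ, ε 0) :: List.ofFn fun j : Fin (2 * r) => (ω j, ε j.succ))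
        (by
          intro p hp
          rw [List.mem_cons] at hp
          rcases hp with rfl | hp
          · exact (norm_eq_one_of_cube hζ3).le
          · exact (hl1 p hp).le)
        (fun f hf => chain_rigid hζ3 hζ1 (ε 0) _ (by simp) hl1 f hf)
      exact ⟨ρ, h0, h1, fun f => by rw [blockOpR_eq_chainOp]; exact h f⟩)
  refine ⟨ρ, h0, h1, fun ζ hζ3 hζ1 ω hω ε f => ?_⟩
  have hmemP : ((ζ, ω), ε) ∈ P := by
    simp only [hP, Finset.mem_product, Finset.mem_filter, Fintype.mem_piFinset, Finset.mem_univ, and_true]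
    exact ⟨⟨hmem.2 hζ3, hζ1⟩, fun j => hmem.2 (hω j)⟩
  exact hQ _ hmemP f

/-- `TwistBoundX3Local`'s two analytic inputs, packaged as in Sketch20x §7 (`twistBoundX3Local_of`'s hypotheses). -/
theorem site_and_block_inputs :
    (∀ (r : ℕ) (ζ : ℂ), ‖ζ‖ ≤ 1 → ∀ (ε : RegState r → Bool → Bool) (f : RegState r → ℂ),
      rnsq (siteOpR ζ ε f) ≤ rnsq f) ∧
    (∀ r : ℕ, ∃ ρ : ℝ, 0 ≤ ρ ∧ ρ < 1 ∧ ∀ (ζ : ℂ), ζ ^ 3 = 1 → ζ ≠ 1 →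
      ∀ (ω : Fin (2 * r) → ℂ), (∀ j, ω j ^ 3 = 1) →
      ∀ (ε : Fin (2 * r + 1) → RegState r → Bool → Bool) (f : RegState r → ℂ),
        rnsq (blockOpR ζ ω ε f) ≤ ρ ^ 2 * rnsq f) :=
  ⟨fun _r _ζ hζ ε f => rnsq_siteOpR_le hζ ε f, blockOpR_contracts⟩

end BondTwist3

end Summit.QuantumAdvantage.AdviceFreeQNC0
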